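import Summits.ABC.IUTFork.Conditional.AbcOfSGenuineKTameShallowInhabitedTwo
import Summits.ABC.IUTFork.Conditional.AbcOfSGenuineKTameShallowInhabitedRatPoint
import Literature.IUT.LogVolume.Corollary22FreyPoint
import HarnessLib

/-!
# Branch C / R-W lane P+: the INHABITED side at RATIONAL points and abc triples, pole order up to `4` (`v_p ≤ 2`) — every pole prime
# `p ∉ {2, l}` of `j(λ)` lattice-large (`60·l + 2 ≤ p`) with `ord_p j(λ) ≥ −4` ⇒ S_H HOLDS at every genuine Θ-volume datum over `(ratPoint λ, l)`

PROOF-ONLY file (no `def`, no new `Prop`, no instance) of the abc-iut cell (WAVE-4 prover seat abc-iut-w4-d107, gen 6; D-0079 R-W, row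
«W:TAME-SHALLOW-INHABITED», lane P+; sequel of `AbcOfSGenuineKTameShallowInhabitedTwo` / `…RatPoint`). TAKES NO SIDE on [IUTchIII] Cor. 3.12
(S. Mochizuki, *Inter-universal Teichmüller theory III*, Cor. 3.12 p. 173–174, Step (xi-f) p. 184) or on any author.

* §3 **`GenuineK.pilotKummerCompatHull_chosen_ratPoint_of_tame_shallow_two_two`** — `λ ∈ ℚ`; if every place `u` of `ℚ` with `p_u ≠ 2, l` at which
  `j(λ)` has a pole satisfies **`60·l + 2 ≤ p_u` and `−4 ≤ ord_u j(λ)`**, then S_H (chosen realising ideles, pinned reading — the per-datum object of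
  `hSHw`/`hSHwBad`) HOLDS at EVERY `T : Cor22.ThetaVolumeDatumAt (ratPoint λ) l`, every choice of the free binders. New input w.r.t. the pole-order-`2`
  file: the Kummer-type bound **`l ≤ e(w|p)`** at the bad places, derived here from `2l·P_q(w) = ord_w(q) = e(w|p)·(−ord_u j(λ))` (abc-iut-w5-d009
  `exists_nat_qPilot_pilotDataOfK`; abc-iut-w4-d026 bookkeeping) with `1 ≤ −ord_u j(λ) ≤ 4 < 5 ≤ l` (`l` prime ⇒ `l ∣ e(w|p)`).
  `…statement_ratPoint_of_tame_shallow_two`: the typed Cor. 3.12 `Statement` at that genuine sharp setting.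
* §4 **`GenuineK.pilotKummerCompatHull_chosen_triple_of_tame_shallow_two_two`** — abc-TRIPLE form `λ = a/c`: every prime `p ∣ abc` with `p ≠ 2, l` has
  **`60·l + 2 ≤ p` and `p³ ∤ abc`** (`TameShallow.poles_of_triple_two_two`: `ord_u j(a/c) = ord_u(2⁸(a²−ac+c²)³) − 2·v_p(abc) ≥ −4`).
* The WORKED ROW with a SQUARED bad prime (`8 + 185753 = 431²` at `l = 7`) is the sequel `AbcOfSGenuineKTameShallowInhabitedTwoRows.lean`.

READING (numbers, not adjectives): with abc-iut-w5-d107's ROBUST refuted side at lattice-tame bad places (`GenuineK.not_pilotKummerCompatHull_chosen_triple_of_sixty_top`: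
`2l ≤ (l−3)·v_p`, i.e. `v_p ≥ 3` for every prime `l ≥ 11`) the typed hull-level clause is now EXACTLY DECIDED, at every genuine Θ-volume datum over an abc
triple all of whose primes `p ∣ abc`, `p ∉ {2, l}`, are `≥ 60·l + 2`, and every prime `l ≥ 11`, by ONE integer: **S_H INHABITED ⟺ max_p v_p(abc) ≤ 2,
REFUTED ⟺ some v_p(abc) ≥ 3** (the equivalence is the conjunction of the two theorems; nothing in between). Szpiro-GOOD rows on the inhabited side, OFF
the certificates' critical path. HONEST SCOPE as in the parents: SHARP reading; OUR containers; STRONGER-THAN-PRINT licence; admissibility ((P2)(P5)(P6),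
core, `U_P`) and NON-EMPTINESS of the datum types NOT claimed; «inhabited as typed» ≠ «true in print»; typed ≠ proved; instantiated ≠ endorsed; no abc
claim. [cite: Mochizuki2012, IUTchIII Cor. 3.12 Step (xi-f) p. 184; IUTchIV Cor. 2.2 (ii) proof (P5) p. 46; IUTchI Def. 3.1 (b),(c) p. 61, Ex. 3.2 (iv) p. 71]
[cite: MochizukiGenEll2010, Thm. 2.1 p. 11] [cite: SilvermanAEC2009, Prop. III.1.7(b)] [cite: DupuyHilado2025, §3.3, §3.4, §4.9]
[claim: Mochizuki2012, status: disputed] for every IUT sentence quoted.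
-/
noncomputable section

open Set Function NumberField IsDedekindDomain

namespace Summit.ABC.IUTFork.Conditional

open Thm311 Thm311.Real Cor312 Cor312Vol Cor312Prov Literature.IUT.LogThetaLattice Literature.IUT.LogVolume
  Literature.IUT.HodgeTheaters Literature.IUT.LogVolume.ThetaData Literature.IUT.LogVolume.Cor22
open Literature.NumberTheory.NumberFields Literature.NumberTheory.GaloisRepresentations.Ultrametric
open Literature.NumberTheory.DiophantineGeometry Literature.NumberTheory.DiophantineGeometry.GenEll
  Literature.NumberTheory.DiophantineGeometry.UniformABCConjecture Summit.ABC.ABC.Theorems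

/-! ## §3. Rational points: large pole primes of order `≤ 4` ⇒ all-tame, shallow, `e(w|p) ≥ l` ⇒ S_H INHABITED -/

/-- **INHABITED S_H AT EVERY GENUINE Θ-VOLUME DATUM OVER A RATIONAL POINT WITH LARGE POLES OF ORDER `≤ 4`.** `λ ∈ ℚ`; suppose every place `u`
of `ℚ` with `p_u ∉ {2, l}` at which `j(λ)` has a pole has `60·l + 2 ≤ p_u` and `ord_u j(λ) ≥ −4`. Then for EVERY `T : Cor22.ThetaVolumeDatumAt (ratPoint λ) l`
the hull-level clause `Cor312Vol.PilotKummerCompatHull` at the genuine sharp setting over `T.K` (CHOSEN realising ideles, PINNED reading — the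
per-datum object of `hSHw`/`hSHwBad`) HOLDS for every choice of the free context binders and Kummer datum: every bad place `w` lies over such a
`u` ((P5) choice + `ord_jE_neg`), every place over `p_u` has `e ∣ 60·l ≤ p_u − 2` (abc-iut-W-neg-1), `ord_w(q) = e(w|u)·(−ord_u j(λ)) ≤ 4·e(w|p_u)`, and
`l ∣ e(w|p_u)` from `2l·P_q(w) = e(w|p_u)·(−ord_u j(λ))`, `−ord_u j(λ) ≤ 4 < l`.
[cite: Mochizuki2012, IUTchIV Cor. 2.2 (ii) proof (P5) p. 46; IUTchIII Cor. 3.12 Step (xi-f) p. 184] [claim: Mochizuki2012, status: disputed] -/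
theorem GenuineK.pilotKummerCompatHull_chosen_ratPoint_of_tame_shallow_two {q : ℚ} {l : ℕ}
    (T : Cor22.ThetaVolumeDatumAt (ratPoint q) l)
    (H : ∀ u : HeightOneSpectrum (𝓞 ℚ), Rat.HeightOneSpectrum.natGenerator u ≠ 2 → Rat.HeightOneSpectrum.natGenerator u ≠ l →
      ord ℚ u (Cor22.jInv q) < 0 → 60 * l + 2 ≤ Rat.HeightOneSpectrum.natGenerator u ∧ -4 ≤ ord ℚ u (Cor22.jInv q)) :
    letI := T.instFieldF; letI := T.instNumberFieldF; letI := T.instAlgebraF; letI := T.instFieldK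
    letI := T.instNumberFieldK; letI := T.instAlgebraK; letI := T.instFieldFbar; letI := T.instAlgebraFbar
    letI := T.instAlgebraKFbar; letI := T.instIsElliptic
    ∀ (M : Type) [Field M] [NumberField M]
      (archPk : ∀ (j : (thetaIndex (pilotDataOfK T.D T.K)).Label) (vQ : (thetaIndex (pilotDataOfK T.D T.K)).VQ),
        Set ((logShellsDH (pilotDataOfK T.D T.K) (analyticLogv T.K)).Packet j vQ))
      (archSub : ∀ (j : (thetaIndex (pilotDataOfK T.D T.K)).Label) (v : (thetaIndex (pilotDataOfK T.D T.K)).V),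
        Set ((logShellsDH (pilotDataOfK T.D T.K) (analyticLogv T.K)).Packet j ((thetaIndex (pilotDataOfK T.D T.K)).over v)))
      (Ψ : ℤ → ∀ v : (thetaIndex (pilotDataOfK T.D T.K)).V, v ∈ (thetaIndex (pilotDataOfK T.D T.K)).Vbad →
        Set ((logShellsDH (pilotDataOfK T.D T.K) (analyticLogv T.K)).StarPacket v))
      (act : ℤ → ∀ v : (thetaIndex (pilotDataOfK T.D T.K)).V, v ∈ (thetaIndex (pilotDataOfK T.D T.K)).Vbad →
        (logShellsDH (pilotDataOfK T.D T.K) (analyticLogv T.K)).StarPacket v →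
          Module.End ℚ ((logShellsDH (pilotDataOfK T.D T.K) (analyticLogv T.K)).StarPacket v))
      (Mmod : ℤ → ∀ j : (thetaIndex (pilotDataOfK T.D T.K)).LabelStar, Set ((logShellsDH (pilotDataOfK T.D T.K) (analyticLogv T.K)).GlobalPacket j.1))
      (region : ℤ → ∀ j : (thetaIndex (pilotDataOfK T.D T.K)).LabelStar, FinDivisor M → ∀ vQ : (thetaIndex (pilotDataOfK T.D T.K)).VQ,
        Set ((logShellsDH (pilotDataOfK T.D T.K) (analyticLogv T.K)).Packet j.1 vQ))
      (frobAdm : ℤ → ℤ → ∀ (j : (thetaIndex (pilotDataOfK T.D T.K)).Label) (vQ : (thetaIndex (pilotDataOfK T.D T.K)).VQ),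
        Set ((logShellsDH (pilotDataOfK T.D T.K) (analyticLogv T.K)).Packet j vQ) → Prop)
      (frobLogvol : ℤ → ℤ → ∀ (j : (thetaIndex (pilotDataOfK T.D T.K)).Label) (vQ : (thetaIndex (pilotDataOfK T.D T.K)).VQ),
        Set ((logShellsDH (pilotDataOfK T.D T.K) (analyticLogv T.K)).Packet j vQ) → ℝ)
      (frobΨ : ℤ → ℤ → ∀ v : (thetaIndex (pilotDataOfK T.D T.K)).V, v ∈ (thetaIndex (pilotDataOfK T.D T.K)).Vbad →
        Set ((logShellsDH (pilotDataOfK T.D T.K) (analyticLogv T.K)).StarPacket v))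
      (frobMmod : ℤ → ℤ → ∀ j : (thetaIndex (pilotDataOfK T.D T.K)).LabelStar, Set ((logShellsDH (pilotDataOfK T.D T.K) (analyticLogv T.K)).GlobalPacket j.1))
      (unitImage : ℤ → ℤ → ℕ → ∀ (j : (thetaIndex (pilotDataOfK T.D T.K)).Label) (vQ : (thetaIndex (pilotDataOfK T.D T.K)).VQ),
        Set ((logShellsDH (pilotDataOfK T.D T.K) (analyticLogv T.K)).Packet j vQ))
      (ballImage : ℤ → ℤ → ∀ (j : (thetaIndex (pilotDataOfK T.D T.K)).Label) (vQ : (thetaIndex (pilotDataOfK T.D T.K)).VQ),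
        Set ((logShellsDH (pilotDataOfK T.D T.K) (analyticLogv T.K)).Packet j vQ))
      (thetaDiv : ℤ → ℤ → LgpDivisor M (thetaIndex (pilotDataOfK T.D T.K)).lstar)
      (n : ℤ) {HT : Type} {LogLink : HT → HT → Type} {IsFull : ∀ {s t : HT}, LogLink s t → Prop}
      (lat : LGPGaussianLogThetaLattice LogLink IsFull)
      {Frd : Type} {IsoF : Frd → Frd → Type} {Ob : Frd → Type} {realify : Frd → Frd} {Strip : Type}
      {IsoS : Strip → Strip → Type} {Mv : ∀ v : (thetaIndex (pilotDataOfK T.D T.K)).V, v ∈ (thetaIndex (pilotDataOfK T.D T.K)).Vbad → Type}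
      [∀ v h, Monoid (Mv v h)]
      (sig : GlobalLGPFrobenioidSignature (thetaIndex (pilotDataOfK T.D T.K)).lstar (thetaIndex (pilotDataOfK T.D T.K)).V
        (· ∈ (thetaIndex (pilotDataOfK T.D T.K)).Vbad) Frd IsoF Ob realify Strip IsoS Mv)
      (split : SplittingMonoids Mv) {ObΔ : Type} {N : ∀ v : (thetaIndex (pilotDataOfK T.D T.K)).V, v ∈ (thetaIndex (pilotDataOfK T.D T.K)).Vbad → Type}
      [∀ v h, Monoid (N v h)] (qData : QPilotData ObΔ N)
      (qK : ∀ v : (thetaIndex (pilotDataOfK T.D T.K)).V, v ∈ (thetaIndex (pilotDataOfK T.D T.K)).Vbad →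
        Set ((logShellsDH (pilotDataOfK T.D T.K) (analyticLogv T.K)).StarPacket v)),
      Cor312Vol.PilotKummerCompatHull
          (LatticeSituation.ofShells (logShellsDH (pilotDataOfK T.D T.K) (analyticLogv T.K)) M archPk archSub
            (summandPiecesPr (pilotDataOfK T.D T.K) (logvAnalytic_analyticLogv (F := T.K))).Adm
            (summandPiecesPr (pilotDataOfK T.D T.K) (logvAnalytic_analyticLogv (F := T.K))).logvol Ψ act Mmod region frobAdm frobLogvol frobΨ
            frobMmod unitImage ballImage thetaDiv)
          (settingPrVolSharp (pilotDataOfK T.D T.K) (logvAnalytic_analyticLogv (F := T.K)) M archPk archSub Ψ act Mmod region n lat sig split qData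
            (exists_realising_qIdeles_pilotDataOfK T.D).choose (exists_realising_thetaIdeles_pilotDataOfK T.D).choose
            (exists_realising_qIdeles_pilotDataOfK T.D).choose_spec.1 (exists_realising_qIdeles_pilotDataOfK T.D).choose_spec.2.1)
          (fun _ => Cor312.Setting.qRegion
            (settingPrVolSharp (pilotDataOfK T.D T.K) (logvAnalytic_analyticLogv (F := T.K)) M archPk archSub Ψ act Mmod region n lat sig split qData
              (exists_realising_qIdeles_pilotDataOfK T.D).choose (exists_realising_thetaIdeles_pilotDataOfK T.D).choose
              (exists_realising_qIdeles_pilotDataOfK T.D).choose_spec.1 (exists_realising_qIdeles_pilotDataOfK T.D).choose_spec.2.1)) qK := by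
  classical
  letI := T.instFieldF; letI := T.instNumberFieldF; letI := T.instAlgebraF; letI := T.instFieldK
  letI := T.instNumberFieldK; letI := T.instAlgebraK; letI := T.instFieldFbar; letI := T.instAlgebraFbar
  letI := T.instAlgebraKFbar; letI := T.instIsElliptic
  intro M _ _ archPk archSub Ψ act Mmod region frobAdm frobLogvol frobΨ frobMmod unitImage ballImage thetaDiv n HT LogLink IsFull lat
    Frd IsoF Ob realify Strip IsoS Mv _ sig split ObΔ N _ qData qK
  set X := pilotDataOfK T.D T.K with hXdef
  have hl5 : 5 ≤ l := T.D.five_le_l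
  -- `j(E) = j(λ)` read in `K`
  have hjF : T.E.j = ((Cor22.jInv q : ℚ) : T.F) := by rw [T.j_eq]; exact eq_ratCast _ _
  have hjK : algebraMap T.F T.K T.E.j = algebraMap ℚ T.K (Cor22.jInv q) := by rw [hjF, map_ratCast, eq_ratCast]
  -- a BAD place `w | p` lies over a place `u` of `ℚ` with `p_u = p ∉ {2, l}` and `ord_u j(λ) < 0`
  have key : ∀ (pp : Nat.Primes) (w : (thetaIndex X).Fibre (.inr pp)),
      haveI : Fact (pp : ℕ).Prime := ⟨pp.2⟩
      placeOf X pp.1 w ∈ X.S → (pp : ℕ) ≠ 2 ∧ (pp : ℕ) ≠ l ∧ ord ℚ (finBelow ℚ T.K (placeOf X pp.1 w)) (Cor22.jInv q) < 0 := by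
    intro pp w hw
    haveI : Fact (pp : ℕ).Prime := ⟨pp.2⟩
    have hv : FinitePlace.mk (finBelow T.F T.K (placeOf X pp.1 w)) ∈ T.D.VFbad := (mem_pilotDataOfK_S_iff T.D T.K _).mp hw
    obtain ⟨h2l, -⟩ := (T.isP5Choice _).mp hv
    have hpv : ((pp : ℕ) : 𝓞 T.F) ∈ (finBelow T.F T.K (placeOf X pp.1 w)).asIdeal := by
      change ((pp : ℕ) : 𝓞 T.F) ∈ Ideal.comap (algebraMap (𝓞 T.F) (𝓞 T.K)) (placeOf X pp.1 w).asIdeal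
      rw [Ideal.mem_comap, map_natCast]
      exact natCast_mem_placeOf X pp.1 w
    have hne : ∀ p' ∈ ({2, l} : Finset ℕ), (pp : ℕ) ≠ p' := by
      intro p' hp' heq
      refine h2l p' hp' ?_
      rw [FinitePlace.maximalIdeal_mk, ← heq]
      exact hpv
    refine ⟨hne 2 (by simp), hne l (by simp), ?_⟩
    have hneg := X.ord_jE_neg _ hw
    rw [show X.jE = algebraMap T.F T.K T.E.j from rfl, hjK, Cor22.ord_algebraMap_neg_iff] at hneg
    exact hneg
  refine GenuineK.pilotKummerCompatHull_chosen_of_tame_shallow_two T.D M archPk archSub Ψ act Mmod region frobAdm frobLogvol frobΨ frobMmod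
    unitImage ballImage thetaDiv n lat sig split qData qK ?_ ?_
  · -- all-tame: the LOCAL-TYPE LEMMA over every prime below a bad place
    rintro pp x ⟨w, hw⟩
    haveI : Fact (pp : ℕ).Prime := ⟨pp.2⟩
    obtain ⟨h2, hl, hneg⟩ := key pp w hw
    have hgen := natGenerator_finBelow_placeOf T.D pp w
    obtain ⟨h60, -⟩ := H _ (by rw [hgen]; exact h2) (by rw [hgen]; exact hl) hneg
    rw [hgen] at h60
    refine ⟨by omega, ?_⟩
    have hpole : ∀ v : HeightOneSpectrum (𝓞 ℚ), Rat.HeightOneSpectrum.natGenerator v = (pp : ℕ) → ord ℚ v (Cor22.jInv q) < 0 := by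
      intro v hv
      have hvu : v = finBelow ℚ T.K (placeOf X pp.1 w) := natGenerator_injective (hv.trans hgen.symm)
      rw [hvu]
      exact hneg
    obtain ⟨hdvd, -⟩ := GenuineK.absRamificationIdx_kOf_dvd_ratPoint T pp h2 (by omega) (by omega) hl hpole x
    have heq : absRamificationIdx (pp : ℕ) (kOf X pp.1 x) = (placeOf X pp.1 x).asIdeal.ramificationIdx ℤ :=
      absRamificationIdx_rescaledCompletion T.K (pp : ℕ) (placeOf X pp.1 x) (natCast_mem_placeOf X pp.1 x)
    rw [heq] at hdvd
    have hle : (placeOf (pilotDataOfK T.D T.K) pp.1 x).asIdeal.ramificationIdx ℤ ≤ 60 * l := Nat.le_of_dvd (by omega) hdvd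
    have hp2' : 60 * l + 2 ≤ (pp : ℕ) := h60
    omega
  · -- shallow: `e(w|v)·ord_v(q_v) = ord_w(q) = e(w|u)·(−ord_u j(λ)) ≤ 2·e(w|u) = 2·e(w|p)`
    intro pp w hw
    haveI : Fact (pp : ℕ).Prime := ⟨pp.2⟩
    obtain ⟨h2, hl, hneg⟩ := key pp w hw
    have hgen := natGenerator_finBelow_placeOf T.D pp w
    obtain ⟨-, hord2⟩ := H _ (by rw [hgen]; exact h2) (by rw [hgen]; exact hl) hneg
    set w' := placeOf X pp.1 w with hw'
    set u := finBelow ℚ T.K w' with hu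
    -- `ordq w' = e(w'|v)·ord_v(q_v)` (ℤ) and `ordq w' = −ord_{w'}(j_E) = −e(w'|u)·ord_u j(λ)`
    have h1 : X.ordq w' = ((finBelow T.F T.K w').asIdeal.ramificationIdx' w'.asIdeal : ℤ) * (qParamOrd T.E (finBelow T.F T.K w') : ℤ) :=
      ordq_pilotDataOfK T.D T.K hw
    have h2' : X.ordq w' = -((u.asIdeal.ramificationIdx' w'.asIdeal : ℤ) * ord ℚ u (Cor22.jInv q)) := by
      unfold PilotData.ordq
      rw [show X.jE = algebraMap T.F T.K T.E.j from rfl, hjK, Cor22.ord_algebraMap_eq]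
    -- `e(w'|p) = e(w'|u)·ord_u(p) = e(w'|u)`
    have h3 : ((w'.asIdeal.ramificationIdx ℤ : ℕ) : ℤ) = (u.asIdeal.ramificationIdx' w'.asIdeal : ℤ) := by
      have h := Cor22.ord_natCast_eq_ramIdx (pp : ℕ) w' (placeOf_mem X pp.1 w)
      rw [ramIdx_eq T.K w', show ((pp : ℕ) : T.K) = algebraMap ℚ T.K ((pp : ℕ) : ℚ) from (map_natCast (algebraMap ℚ T.K) pp).symm,
        Cor22.ord_algebraMap_eq, ord_rat_finBelow_placeOf_eq_one T.D pp w, mul_one] at h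
      exact h.symm
    have he0 : (0 : ℤ) ≤ (u.asIdeal.ramificationIdx' w'.asIdeal : ℤ) := by positivity
    have hZ : ((finBelow T.F T.K w').asIdeal.ramificationIdx' w'.asIdeal : ℤ) * (qParamOrd T.E (finBelow T.F T.K w') : ℤ) ≤
        4 * ((w'.asIdeal.ramificationIdx ℤ : ℕ) : ℤ) := by
      rw [← h1, h2', h3]
      nlinarith
    refine ⟨by exact_mod_cast hZ, ?_⟩
    -- `l ∣ e(w'|p)`: `2l·P = ord_{w'}(q) = e(w'|p)·(−ord_u j(λ))` with `1 ≤ −ord_u j(λ) ≤ 4 < l`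
    obtain ⟨P, -, hP1, hPeq⟩ := exists_nat_qPilot_pilotDataOfK T.D hw
    obtain ⟨hh, hhdef⟩ : ∃ hh : ℕ, (hh : ℤ) = -ord ℚ u (Cor22.jInv q) := ⟨(-ord ℚ u (Cor22.jInv q)).toNat, Int.toNat_of_nonneg (by omega)⟩
    have hh1 : 1 ≤ hh := by omega
    have hh4 : hh ≤ 4 := by omega
    have hprod : (w'.asIdeal.ramificationIdx ℤ) * hh = 2 * l * P := by
      have hq : X.ordq w' = ((2 * l * P : ℕ) : ℤ) := by rw [h1]; exact_mod_cast hPeq.symm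
      have hZ2 : (((w'.asIdeal.ramificationIdx ℤ : ℕ) : ℤ)) * (hh : ℤ) = ((2 * l * P : ℕ) : ℤ) := by
        rw [← hq, h2', hhdef, h3]
        ring
      exact_mod_cast hZ2
    have hdvd : l ∣ (w'.asIdeal.ramificationIdx ℤ) * hh := ⟨2 * P, by rw [hprod]; ring⟩
    have hcop : Nat.Coprime l hh := Nat.coprime_of_lt_prime (by omega) (by omega) T.D.l_prime
    have hdvd' : l ∣ w'.asIdeal.ramificationIdx ℤ := hcop.dvd_of_dvd_mul_right hdvd
    have hpos : 0 < w'.asIdeal.ramificationIdx ℤ :=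
      Nat.pos_of_ne_zero fun h0 => by
        have hlp : 0 < 2 * l * P := by positivity
        rw [h0, zero_mul] at hprod
        omega
    exact Nat.le_of_dvd hpos hdvd'

/-- **THE TYPED STATEMENT OF [IUTchIII] Cor. 3.12 HOLDS at the genuine sharp setting of every such datum** (same hypotheses; every choice of the
context binders of abc-iut-c312-7's `settingPrVolSharp` over `Cor312Prov.pilotDataOfK T.D T.K` with the chosen realising ideles).
[cite: Mochizuki2012, IUTchIII Cor. 3.12 p. 173–174] [claim: Mochizuki2012, status: disputed] -/
theorem GenuineK.statement_ratPoint_of_tame_shallow_two {q : ℚ} {l : ℕ}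
    (T : Cor22.ThetaVolumeDatumAt (ratPoint q) l)
    (H : ∀ u : HeightOneSpectrum (𝓞 ℚ), Rat.HeightOneSpectrum.natGenerator u ≠ 2 → Rat.HeightOneSpectrum.natGenerator u ≠ l →
      ord ℚ u (Cor22.jInv q) < 0 → 60 * l + 2 ≤ Rat.HeightOneSpectrum.natGenerator u ∧ -4 ≤ ord ℚ u (Cor22.jInv q)) :
    letI := T.instFieldF; letI := T.instNumberFieldF; letI := T.instAlgebraF; letI := T.instFieldK
    letI := T.instNumberFieldK; letI := T.instAlgebraK; letI := T.instFieldFbar; letI := T.instAlgebraFbar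
    letI := T.instAlgebraKFbar; letI := T.instIsElliptic
    ∀ (M : Type) [Field M] [NumberField M]
      (archPk : ∀ (j : (thetaIndex (pilotDataOfK T.D T.K)).Label) (vQ : (thetaIndex (pilotDataOfK T.D T.K)).VQ),
        Set ((logShellsDH (pilotDataOfK T.D T.K) (analyticLogv T.K)).Packet j vQ))
      (archSub : ∀ (j : (thetaIndex (pilotDataOfK T.D T.K)).Label) (v : (thetaIndex (pilotDataOfK T.D T.K)).V),
        Set ((logShellsDH (pilotDataOfK T.D T.K) (analyticLogv T.K)).Packet j ((thetaIndex (pilotDataOfK T.D T.K)).over v)))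
      (Ψ : ℤ → ∀ v : (thetaIndex (pilotDataOfK T.D T.K)).V, v ∈ (thetaIndex (pilotDataOfK T.D T.K)).Vbad →
        Set ((logShellsDH (pilotDataOfK T.D T.K) (analyticLogv T.K)).StarPacket v))
      (act : ℤ → ∀ v : (thetaIndex (pilotDataOfK T.D T.K)).V, v ∈ (thetaIndex (pilotDataOfK T.D T.K)).Vbad →
        (logShellsDH (pilotDataOfK T.D T.K) (analyticLogv T.K)).StarPacket v →
          Module.End ℚ ((logShellsDH (pilotDataOfK T.D T.K) (analyticLogv T.K)).StarPacket v))
      (Mmod : ℤ → ∀ j : (thetaIndex (pilotDataOfK T.D T.K)).LabelStar, Set ((logShellsDH (pilotDataOfK T.D T.K) (analyticLogv T.K)).GlobalPacket j.1))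
      (region : ℤ → ∀ j : (thetaIndex (pilotDataOfK T.D T.K)).LabelStar, FinDivisor M → ∀ vQ : (thetaIndex (pilotDataOfK T.D T.K)).VQ,
        Set ((logShellsDH (pilotDataOfK T.D T.K) (analyticLogv T.K)).Packet j.1 vQ))
      (n : ℤ) {HT : Type} {LogLink : HT → HT → Type} {IsFull : ∀ {s t : HT}, LogLink s t → Prop}
      (lat : LGPGaussianLogThetaLattice LogLink IsFull)
      {Frd : Type} {IsoF : Frd → Frd → Type} {Ob : Frd → Type} {realify : Frd → Frd} {Strip : Type}
      {IsoS : Strip → Strip → Type} {Mv : ∀ v : (thetaIndex (pilotDataOfK T.D T.K)).V, v ∈ (thetaIndex (pilotDataOfK T.D T.K)).Vbad → Type}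
      [∀ v h, Monoid (Mv v h)]
      (sig : GlobalLGPFrobenioidSignature (thetaIndex (pilotDataOfK T.D T.K)).lstar (thetaIndex (pilotDataOfK T.D T.K)).V
        (· ∈ (thetaIndex (pilotDataOfK T.D T.K)).Vbad) Frd IsoF Ob realify Strip IsoS Mv)
      (split : SplittingMonoids Mv) {ObΔ : Type} {N : ∀ v : (thetaIndex (pilotDataOfK T.D T.K)).V, v ∈ (thetaIndex (pilotDataOfK T.D T.K)).Vbad → Type}
      [∀ v h, Monoid (N v h)] (qData : QPilotData ObΔ N),
      (settingPrVolSharp (pilotDataOfK T.D T.K) (logvAnalytic_analyticLogv (F := T.K)) M archPk archSub Ψ act Mmod region n lat sig split qData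
        (exists_realising_qIdeles_pilotDataOfK T.D).choose (exists_realising_thetaIdeles_pilotDataOfK T.D).choose
        (exists_realising_qIdeles_pilotDataOfK T.D).choose_spec.1 (exists_realising_qIdeles_pilotDataOfK T.D).choose_spec.2.1).Statement := by
  classical
  letI := T.instFieldF; letI := T.instNumberFieldF; letI := T.instAlgebraF; letI := T.instFieldK
  letI := T.instNumberFieldK; letI := T.instAlgebraK; letI := T.instFieldFbar; letI := T.instAlgebraFbar
  letI := T.instAlgebraKFbar; letI := T.instIsElliptic
  intro M _ _ archPk archSub Ψ act Mmod region n HT LogLink IsFull lat Frd IsoF Ob realify Strip IsoS Mv _ sig split ObΔ N _ qData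
  -- the hull clause with trivial column binders gives the licence, hence the Statement
  have hSH := GenuineK.pilotKummerCompatHull_chosen_ratPoint_of_tame_shallow_two T H M archPk archSub Ψ act Mmod region
    (fun _ _ _ _ _ => True) (fun _ _ _ _ _ => 0) (fun m _ => Ψ m) (fun m _ => Mmod m) (fun _ _ _ _ _ => ∅) (fun _ _ _ _ => ∅)
    (fun _ _ => 0) n lat sig split qData (fun _ _ => ∅)
  exact Thm311ToCor312.statement_of_licence
    (bridgeHyps_settingPrVolSharp_of_ideles (pilotDataOfK T.D T.K) (logvAnalytic_analyticLogv (F := T.K)) M archPk archSub Ψ act Mmod region n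
      lat sig split qData (tq := (exists_realising_qIdeles_pilotDataOfK T.D).choose) (t := (exists_realising_thetaIdeles_pilotDataOfK T.D).choose)
      (exists_realising_thetaIdeles_pilotDataOfK T.D).choose_spec.1 (exists_realising_thetaIdeles_pilotDataOfK T.D).choose_spec.2.1
      (exists_realising_qIdeles_pilotDataOfK T.D).choose_spec.1 (exists_realising_qIdeles_pilotDataOfK T.D).choose_spec.2.1)
    (licence_of_pilotKummerCompatHull _ _ _ _ (fun _ _ => rfl) hSH)

/-! ## §4. abc triples: every odd prime `p ∣ abc`, `p ≠ l`, with `60·l + 2 ≤ p` and `p³ ∤ abc` (`v_p(abc) ≤ 2`) -/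

/-- A natural number prime to `p_v` has `ord_v = 0`. [folklore] -/
private theorem ord_rat_natCast_eq_zero_of_not_dvd' (v : HeightOneSpectrum (𝓞 ℚ)) {n : ℕ}
    (h : ¬ Rat.HeightOneSpectrum.natGenerator v ∣ n) : ord ℚ v (n : ℚ) = 0 := by
  unfold ord
  rw [(valuation_natCast_eq_one_iff v n).2 h, WithZero.log_one, neg_zero]

/-- Natural numbers have `ord_v ≥ 0`. [folklore] -/
private theorem ord_rat_natCast_nonneg' (v : HeightOneSpectrum (𝓞 ℚ)) (n : ℕ) : 0 ≤ ord ℚ v (n : ℚ) := by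
  simpa using ord_nonneg_of_isIntegral ℚ v (n : 𝓞 ℚ)

/-- **Poles of the Frey–Legendre `j`-invariant of an abc triple with large odd primes of multiplicity `≤ 2`.** For `a + b = c` coprime and a place
`u` of `ℚ` with `p_u ≠ 2, l` at which `j(a/c) = 2⁸(a²−ac+c²)³/(abc)²` has a pole: `p_u ∣ abc`, so if every such prime has `60·l + 2 ≤ p` and `p³ ∤ abc`
then `60·l + 2 ≤ p_u` and `ord_u j(a/c) ≥ −2·v_p(abc) ≥ −4`. [cite: SilvermanAEC2009, Prop. III.1.7(b)] [cite: MochizukiGenEll2010, Thm. 2.1 p. 11] -/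
theorem TameShallow.poles_of_triple_two {a b c : ℕ} (habc : IsABCTriple a b c) {l : ℕ}
    (hprimes : ∀ p : ℕ, p.Prime → p ∣ a * b * c → p ≠ 2 → p ≠ l → 60 * l + 2 ≤ p ∧ ¬ p ^ 3 ∣ a * b * c)
    (u : HeightOneSpectrum (𝓞 ℚ)) (hu2 : Rat.HeightOneSpectrum.natGenerator u ≠ 2) (hul : Rat.HeightOneSpectrum.natGenerator u ≠ l)
    (hord : ord ℚ u (Cor22.jInv ((a : ℚ) / c)) < 0) :
    60 * l + 2 ≤ Rat.HeightOneSpectrum.natGenerator u ∧ -4 ≤ ord ℚ u (Cor22.jInv ((a : ℚ) / c)) := by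
  obtain ⟨ha, hb, hsum, hcop⟩ := habc
  set p := Rat.HeightOneSpectrum.natGenerator u with hp
  have hpp : p.Prime := Rat.HeightOneSpectrum.prime_natGenerator u
  have habc0 : a * b * c ≠ 0 := Nat.mul_ne_zero (Nat.mul_ne_zero ha.ne' hb.ne') (by omega)
  have hN0 : ((256 * (c * b + a * a) ^ 3 : ℕ) : ℚ) ≠ 0 := by
    have : 256 * (c * b + a * a) ^ 3 ≠ 0 := Nat.mul_ne_zero (by norm_num) (pow_ne_zero _ (by nlinarith))
    exact_mod_cast this
  have hD0 : (((a * b * c) ^ 2 : ℕ) : ℚ) ≠ 0 := by exact_mod_cast pow_ne_zero 2 habc0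
  -- `ord_u j = ord_u(N) − 2·ord_u(abc)`
  have hj : ord ℚ u (Cor22.jInv ((a : ℚ) / c)) = ord ℚ u ((256 * (c * b + a * a) ^ 3 : ℕ) : ℚ) - 2 * ord ℚ u ((a * b * c : ℕ) : ℚ) := by
    rw [Cor22.jInv_ratPoint_triple ⟨ha, hb, hsum, hcop⟩, div_eq_mul_inv, ord_mul ℚ u hN0 (inv_ne_zero hD0), ord_inv,
      show (((a * b * c) ^ 2 : ℕ) : ℚ) = ((a * b * c : ℕ) : ℚ) ^ 2 by push_cast; ring, ord_pow]
    ring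
  have hN := ord_rat_natCast_nonneg' u (256 * (c * b + a * a) ^ 3)
  -- `p ∣ abc` (otherwise `ord_u j ≥ 0`)
  have hpabc : p ∣ a * b * c := by
    by_contra hnd
    have h0 := ord_rat_natCast_eq_zero_of_not_dvd' u hnd
    rw [hj, h0] at hord
    linarith
  obtain ⟨h60, hcube⟩ := hprimes p hpp hpabc hu2 hul
  refine ⟨h60, ?_⟩
  -- `abc = p^k·m` with `p ∤ m` and `k = v_p(abc) ≤ 2`, so `ord_u(abc) = k ≤ 2`
  set k := (a * b * c).factorization p with hk
  set m := ordCompl[p] (a * b * c) with hm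
  have hk2 : k ≤ 2 := by
    by_contra h3
    exact hcube ((hpp.pow_dvd_iff_le_factorization habc0).2 (by omega))
  have hdec : ((a * b * c : ℕ) : ℚ) = ((p : ℚ) ^ k) * (m : ℚ) := by
    have := Nat.ordProj_mul_ordCompl_eq_self (a * b * c) p
    rw [← hm] at this
    exact_mod_cast this.symm
  have hpm : ¬ p ∣ m := Nat.not_dvd_ordCompl hpp habc0
  have hm0 : (m : ℚ) ≠ 0 := by exact_mod_cast (Nat.ordCompl_pos p habc0).ne'
  have hp0 : (p : ℚ) ≠ 0 := by exact_mod_cast hpp.ne_zero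
  have hordk : ord ℚ u ((a * b * c : ℕ) : ℚ) = k := by
    rw [hdec, ord_mul ℚ u (pow_ne_zero _ hp0) hm0, ord_pow, hp, Cor22.ord_natGenerator_eq_one u, ord_rat_natCast_eq_zero_of_not_dvd' u hpm]
    ring
  rw [hj, hordk]
  have : (k : ℤ) ≤ 2 := by exact_mod_cast hk2
  linarith

/-- **abc-TRIPLE form, multiplicity `≤ 2`.** `a + b = c` coprime, `λ = a/c`; if every prime `p ∣ abc` with `p ≠ 2, l` has **`60·l + 2 ≤ p` and
`p³ ∤ abc`**, then S_H HOLDS at EVERY genuine Θ-volume datum over `(ratPoint (a/c), l)` (chosen ideles, pinned reading, every choice of the free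
binders) — and so does the typed Cor. 3.12 Statement there (`GenuineK.statement_ratPoint_of_tame_shallow_two` with `TameShallow.poles_of_triple_two`).
[cite: MochizukiGenEll2010, Thm. 2.1 p. 11] [cite: Mochizuki2012, IUTchIII Cor. 3.12 Step (xi-f) p. 184] [claim: Mochizuki2012, status: disputed] -/
theorem GenuineK.pilotKummerCompatHull_chosen_triple_of_tame_shallow_two {a b c : ℕ} (habc : IsABCTriple a b c) {l : ℕ}
    (hprimes : ∀ p : ℕ, p.Prime → p ∣ a * b * c → p ≠ 2 → p ≠ l → 60 * l + 2 ≤ p ∧ ¬ p ^ 3 ∣ a * b * c)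
    (T : Cor22.ThetaVolumeDatumAt (ratPoint ((a : ℚ) / c)) l) :
    letI := T.instFieldF; letI := T.instNumberFieldF; letI := T.instAlgebraF; letI := T.instFieldK
    letI := T.instNumberFieldK; letI := T.instAlgebraK; letI := T.instFieldFbar; letI := T.instAlgebraFbar
    letI := T.instAlgebraKFbar; letI := T.instIsElliptic
    ∀ (M : Type) [Field M] [NumberField M]
      (archPk : ∀ (j : (thetaIndex (pilotDataOfK T.D T.K)).Label) (vQ : (thetaIndex (pilotDataOfK T.D T.K)).VQ),
        Set ((logShellsDH (pilotDataOfK T.D T.K) (analyticLogv T.K)).Packet j vQ))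
      (archSub : ∀ (j : (thetaIndex (pilotDataOfK T.D T.K)).Label) (v : (thetaIndex (pilotDataOfK T.D T.K)).V),
        Set ((logShellsDH (pilotDataOfK T.D T.K) (analyticLogv T.K)).Packet j ((thetaIndex (pilotDataOfK T.D T.K)).over v)))
      (Ψ : ℤ → ∀ v : (thetaIndex (pilotDataOfK T.D T.K)).V, v ∈ (thetaIndex (pilotDataOfK T.D T.K)).Vbad →
        Set ((logShellsDH (pilotDataOfK T.D T.K) (analyticLogv T.K)).StarPacket v))
      (act : ℤ → ∀ v : (thetaIndex (pilotDataOfK T.D T.K)).V, v ∈ (thetaIndex (pilotDataOfK T.D T.K)).Vbad →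
        (logShellsDH (pilotDataOfK T.D T.K) (analyticLogv T.K)).StarPacket v →
          Module.End ℚ ((logShellsDH (pilotDataOfK T.D T.K) (analyticLogv T.K)).StarPacket v))
      (Mmod : ℤ → ∀ j : (thetaIndex (pilotDataOfK T.D T.K)).LabelStar, Set ((logShellsDH (pilotDataOfK T.D T.K) (analyticLogv T.K)).GlobalPacket j.1))
      (region : ℤ → ∀ j : (thetaIndex (pilotDataOfK T.D T.K)).LabelStar, FinDivisor M → ∀ vQ : (thetaIndex (pilotDataOfK T.D T.K)).VQ,
        Set ((logShellsDH (pilotDataOfK T.D T.K) (analyticLogv T.K)).Packet j.1 vQ))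
      (frobAdm : ℤ → ℤ → ∀ (j : (thetaIndex (pilotDataOfK T.D T.K)).Label) (vQ : (thetaIndex (pilotDataOfK T.D T.K)).VQ),
        Set ((logShellsDH (pilotDataOfK T.D T.K) (analyticLogv T.K)).Packet j vQ) → Prop)
      (frobLogvol : ℤ → ℤ → ∀ (j : (thetaIndex (pilotDataOfK T.D T.K)).Label) (vQ : (thetaIndex (pilotDataOfK T.D T.K)).VQ),
        Set ((logShellsDH (pilotDataOfK T.D T.K) (analyticLogv T.K)).Packet j vQ) → ℝ)
      (frobΨ : ℤ → ℤ → ∀ v : (thetaIndex (pilotDataOfK T.D T.K)).V, v ∈ (thetaIndex (pilotDataOfK T.D T.K)).Vbad →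
        Set ((logShellsDH (pilotDataOfK T.D T.K) (analyticLogv T.K)).StarPacket v))
      (frobMmod : ℤ → ℤ → ∀ j : (thetaIndex (pilotDataOfK T.D T.K)).LabelStar, Set ((logShellsDH (pilotDataOfK T.D T.K) (analyticLogv T.K)).GlobalPacket j.1))
      (unitImage : ℤ → ℤ → ℕ → ∀ (j : (thetaIndex (pilotDataOfK T.D T.K)).Label) (vQ : (thetaIndex (pilotDataOfK T.D T.K)).VQ),
        Set ((logShellsDH (pilotDataOfK T.D T.K) (analyticLogv T.K)).Packet j vQ))
      (ballImage : ℤ → ℤ → ∀ (j : (thetaIndex (pilotDataOfK T.D T.K)).Label) (vQ : (thetaIndex (pilotDataOfK T.D T.K)).VQ),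
        Set ((logShellsDH (pilotDataOfK T.D T.K) (analyticLogv T.K)).Packet j vQ))
      (thetaDiv : ℤ → ℤ → LgpDivisor M (thetaIndex (pilotDataOfK T.D T.K)).lstar)
      (n : ℤ) {HT : Type} {LogLink : HT → HT → Type} {IsFull : ∀ {s t : HT}, LogLink s t → Prop}
      (lat : LGPGaussianLogThetaLattice LogLink IsFull)
      {Frd : Type} {IsoF : Frd → Frd → Type} {Ob : Frd → Type} {realify : Frd → Frd} {Strip : Type}
      {IsoS : Strip → Strip → Type} {Mv : ∀ v : (thetaIndex (pilotDataOfK T.D T.K)).V, v ∈ (thetaIndex (pilotDataOfK T.D T.K)).Vbad → Type}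
      [∀ v h, Monoid (Mv v h)]
      (sig : GlobalLGPFrobenioidSignature (thetaIndex (pilotDataOfK T.D T.K)).lstar (thetaIndex (pilotDataOfK T.D T.K)).V
        (· ∈ (thetaIndex (pilotDataOfK T.D T.K)).Vbad) Frd IsoF Ob realify Strip IsoS Mv)
      (split : SplittingMonoids Mv) {ObΔ : Type} {N : ∀ v : (thetaIndex (pilotDataOfK T.D T.K)).V, v ∈ (thetaIndex (pilotDataOfK T.D T.K)).Vbad → Type}
      [∀ v h, Monoid (N v h)] (qData : QPilotData ObΔ N)
      (qK : ∀ v : (thetaIndex (pilotDataOfK T.D T.K)).V, v ∈ (thetaIndex (pilotDataOfK T.D T.K)).Vbad →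
        Set ((logShellsDH (pilotDataOfK T.D T.K) (analyticLogv T.K)).StarPacket v)),
      Cor312Vol.PilotKummerCompatHull
          (LatticeSituation.ofShells (logShellsDH (pilotDataOfK T.D T.K) (analyticLogv T.K)) M archPk archSub
            (summandPiecesPr (pilotDataOfK T.D T.K) (logvAnalytic_analyticLogv (F := T.K))).Adm
            (summandPiecesPr (pilotDataOfK T.D T.K) (logvAnalytic_analyticLogv (F := T.K))).logvol Ψ act Mmod region frobAdm frobLogvol frobΨ
            frobMmod unitImage ballImage thetaDiv)
          (settingPrVolSharp (pilotDataOfK T.D T.K) (logvAnalytic_analyticLogv (F := T.K)) M archPk archSub Ψ act Mmod region n lat sig split qData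
            (exists_realising_qIdeles_pilotDataOfK T.D).choose (exists_realising_thetaIdeles_pilotDataOfK T.D).choose
            (exists_realising_qIdeles_pilotDataOfK T.D).choose_spec.1 (exists_realising_qIdeles_pilotDataOfK T.D).choose_spec.2.1)
          (fun _ => Cor312.Setting.qRegion
            (settingPrVolSharp (pilotDataOfK T.D T.K) (logvAnalytic_analyticLogv (F := T.K)) M archPk archSub Ψ act Mmod region n lat sig split qData
              (exists_realising_qIdeles_pilotDataOfK T.D).choose (exists_realising_thetaIdeles_pilotDataOfK T.D).choose
              (exists_realising_qIdeles_pilotDataOfK T.D).choose_spec.1 (exists_realising_qIdeles_pilotDataOfK T.D).choose_spec.2.1)) qK :=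
  GenuineK.pilotKummerCompatHull_chosen_ratPoint_of_tame_shallow_two T
    (fun u hu2 hul hord => TameShallow.poles_of_triple_two habc hprimes u hu2 hul hord)

end Summit.ABC.IUTFork.Conditional

end
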